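import Mathlib
import HarnessLib
import Summits.FinalStateConjecture.FinalStateConjecture.Theorems.LogTimeThreeAnnuliDyadicCaptureCaptureUpgradeA

/-!
# Route LogTimeThreeAnnuli · crux `DyadicCapture` · line `registered` — capture upgrade, part B

The `Cᵏ` UPGRADE without summability (lead c3, skeleton v6 of the line): over ANY spacetime, a smooth
chart `Ψ` on a reference boosted Kerr exterior `boostedKerrExterior Λ c M' a'` (`0 < M'`) which is
(i) `C⁰`-normalised — `Ψ^* g → g_{M',a'}` in `C⁰` on every fixed slab `{t* = τ, r ≤ ρ}` — and
(ii) windowed-close — for every `k, ρ, ε` eventually some member of the compact window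
`W = {m₀ ≤ M ≤ 1/m₀, |a| ≤ χM}` is `ε`-close in `Cᵏ` on the fixed slab of radius `ρ` and on the growing
slab of radius `R(τ)` — converges to its OWN reference member in every `Cᵏ`, on fixed and on growing
slabs, and the reference member lies in the window (`captureC_main`, part C; this part: fixed slabs).

* `captureB_uniform_jets` — uniform continuity of the slab jets in the parameters: for `p → (M', a')`,
  `sup_{y ∈ slab(ρ, τ)} ‖Dᵐ(g_p − g_{M',a'})(y)‖ → 0` uniformly in `τ` (stationarity reduces to the compact
  closure of the time-`0` slab; joint jet continuity `captureA_continuousAt_jets₂` and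
  `IsCompact.mem_uniformity_of_prod`).
* `captureB_tendsto_fixed` — (i) + (ii, fixed part) ⟹ `Cᵏ` convergence on fixed slabs: at a late time the
  window member `p(τ)` and the reference member are both `C⁰`-close to `Ψ^* g` on the anchor slab, hence
  close to each other (`captureA_dist_lt_of_le`), and `δᵏ_ρ(τ; M', a') ≤ δᵏ_ρ(τ; p(τ)) + sup ‖Dᵐ(g_{p(τ)} −
  g_{M',a'})‖`.
* growing slabs and the chart-level assembly `captureC_main`: part C
  (`LogTimeThreeAnnuliDyadicCaptureCaptureUpgradeC.lean`).

Sources: Kerr–Schild 1965 §2–§3 (the explicit stationary family, its fall-off); DHRT arXiv:2104.08222 §1.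
-/

-- the `Summit.FinalStateConjecture.FinalStateConjecture.…` namespace repeats the summit = sub-problem
-- segment (D-0017 layout, CONVENTIONS §2); the duplicate is deliberate.
set_option linter.dupNamespace false

noncomputable section

namespace Summit.FinalStateConjecture.FinalStateConjecture.Theorems

open Literature.Geometry.Lorentzian
open scoped Topology Manifold ENNReal ContDiff
open Filter Set

/-! ### Small facts -/

/-- Undoing the inverse Poincaré map: `c + Λ(Λ⁻¹(y − c)) = y`. [folklore] -/
theorem captureB_boost_poincareInv (Λ : lorentzGroup) (c y : E4) :
    c + (Λ : E4 ≃L[ℝ] E4) (poincareInv Λ c y) = y := by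
  simp [poincareInv]

/-- **The closed rest-frame slab is compact**: `{z | z 0 = 0, r₊' ≤ r_{a'}(z) ≤ ρ}` is closed and bounded
(`‖z‖² = ‖z⃗‖² ≤ r_{a'}² + a'² ≤ ρ² + a'²`, `Kerr.spatialNorm_sq_sub_sq_le_radius_sq`). [folklore] -/
theorem captureB_isCompact_restSlab (M' a' ρ : ℝ) :
    IsCompact {z : E4 | z 0 = 0 ∧ Kerr.rPlus M' a' ≤ Kerr.radius a' z ∧ Kerr.radius a' z ≤ ρ} := by
  refine Metric.isCompact_of_isClosed_isBounded ?_ ?_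
  · refine (isClosed_eq ?_ continuous_const).inter
      ((isClosed_le continuous_const (Kerr.continuous_radius a')).inter
        (isClosed_le (Kerr.continuous_radius a') continuous_const))
    fun_prop
  · rw [Metric.isBounded_iff_subset_closedBall (0 : E4)]
    refine ⟨|ρ| + |a'|, fun z hz ↦ ?_⟩
    obtain ⟨h0, -, hr⟩ := hz
    rw [Metric.mem_closedBall, dist_zero_right]
    have h1 := Kerr.spatialNorm_sq_sub_sq_le_radius_sq a' z
    -- `‖z‖² = (z 0)² + ‖z⃗‖²` (cf. `norm_sq_eq_sq_add_spatialNorm_sq`)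
    have h2 : ‖z‖ ^ 2 = z 0 ^ 2 + E4.spatialNorm z ^ 2 := by
      rw [EuclideanSpace.norm_sq_eq, Fin.sum_univ_four, E4.spatialNorm_sq]
      simp only [Real.norm_eq_abs, sq_abs]
      ring
    rw [h0] at h2
    have hr0 := Kerr.radius_nonneg a' z
    have h3 : Kerr.radius a' z ^ 2 ≤ |ρ| ^ 2 := pow_le_pow_left₀ hr0 (hr.trans (le_abs_self ρ)) 2
    have h4 : ‖z‖ ^ 2 ≤ (|ρ| + |a'|) ^ 2 := by
      have ha : a' ^ 2 = |a'| ^ 2 := (sq_abs a').symm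
      nlinarith [abs_nonneg ρ, abs_nonneg a']
    exact (pow_le_pow_iff_left₀ (norm_nonneg z) (by positivity) two_ne_zero).1 h4

/-! ### Uniform continuity of the slab jets in the parameters -/

section Chart

variable {𝓢 : Spacetime.{0} 4} (Λ : lorentzGroup) (c : E4) (M' a' : ℝ)
  (Ψ : (boostedKerrExterior Λ c M' a') → 𝓢.carrier)

-- long statements; the structure-update backgrounds and the operator-norm instance paths unify slowly
set_option synthInstance.maxHeartbeats 200000 in
set_option maxHeartbeats 1600000 in
/-- **Uniform continuity of the slab jets in the parameters, one order.** For `0 < M'`, every `m`, `ρ`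
and `ε > 0` there is `θ > 0` such that every `p` with `dist p (M', a') < θ` satisfies
`‖Dᵐ(g_p − g_{M',a'})(y)‖ ≤ ε` at every point `y` of every slab `{t* = τ, r ≤ ρ}` (all `τ`): by
stationarity of the family along the Killing orbit the slab at time `τ` is carried to the one at time
`0`, whose rest-frame closure is compact, and there the jets are jointly continuous in `(p, y)`
(`captureA_continuousAt_jets₂`, `IsCompact.mem_uniformity_of_prod`). [cite: KerrSchild1965, §2] -/
theorem captureB_uniform_jets (hM' : 0 < M') (m : ℕ) (ρ : ℝ) {ε : ℝ} (hε : 0 < ε) :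
    ∃ θ : ℝ, 0 < θ ∧ ∀ p : ℝ × ℝ, dist p (M', a') < θ → ∀ (τ : ℝ),
      ∀ y ∈ Subtype.val '' (({boostedKerrBackground Λ c M' a' with bilin := boostedKerrBilin Λ c M' a'} : ModelBackground)).truncTimeSlab ρ τ,
        0 < Kerr.radius p.2 (poincareInv Λ c y) ∧
        ‖iteratedFDeriv ℝ m (fun z ↦ boostedKerrBilin Λ c p.1 p.2 z - boostedKerrBilin Λ c M' a' z) y‖ ≤ ε := by
  set rp : ℝ := Kerr.rPlus M' a' with hrp
  -- `0 < r₊` for `0 < M'` (cf. `Literature.Barriers.FinalStateConjecture.rPlus_pos_of_pos`)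
  have hrp0 : 0 < rp := by
    have := Real.sqrt_nonneg (M' ^ 2 - a' ^ 2)
    simp only [hrp, Kerr.rPlus]; linarith
  -- the compact closed rest-frame slab and its boosted image
  set Kz : Set E4 := {z : E4 | z 0 = 0 ∧ rp ≤ Kerr.radius a' z ∧ Kerr.radius a' z ≤ ρ} with hKz
  have hKzc : IsCompact Kz := captureB_isCompact_restSlab M' a' ρ
  set K : Set E4 := (fun z : E4 ↦ c + (Λ : E4 ≃L[ℝ] E4) z) '' Kz with hK
  have hKc : IsCompact K := hKzc.image (by fun_prop)
  -- the open parameter set on which every member is smooth near `K`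
  set s : Set (ℝ × ℝ) := {p | p.2 ^ 2 < a' ^ 2 + rp ^ 2} with hs
  have hso : IsOpen s := isOpen_lt (continuous_snd.pow 2) continuous_const
  have hps : ((M', a') : ℝ × ℝ) ∈ s := by
    show a' ^ 2 < a' ^ 2 + rp ^ 2
    nlinarith
  have hrad : ∀ p ∈ s, ∀ z ∈ Kz, 0 < Kerr.radius p.2 z := fun p hp z hz ↦
    captureA_radius_pos_of_sq_lt hrp0 hz.2.1 hp
  -- joint continuity of the jets on `s × K`
  set f := fun (p : ℝ × ℝ) (y : E4) ↦ iteratedFDeriv ℝ m (boostedKerrBilin Λ c p.1 p.2) y with hf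
  have hfc : ContinuousOn f.uncurry (s ×ˢ K) := by
    rintro ⟨p, y⟩ ⟨hp, hy⟩
    obtain ⟨z, hz, rfl⟩ := hy
    have hr : 0 < Kerr.radius p.2 (poincareInv Λ c (c + (Λ : E4 ≃L[ℝ] E4) z)) := by
      rw [freezing_poincareInv_boost]
      exact hrad p hp z hz
    exact (captureA_continuousAt_jets₂ Λ c m (q₀ := (p, c + (Λ : E4 ≃L[ℝ] E4) z)) hr).continuousWithinAt
  obtain ⟨v, hv, hvu⟩ := hKc.mem_uniformity_of_prod hfc hps (Metric.dist_mem_uniformity hε)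
  rw [hso.nhdsWithin_eq hps] at hv
  obtain ⟨θ₁, hθ₁, hball₁⟩ := Metric.mem_nhds_iff.1 hv
  obtain ⟨θ₂, hθ₂, hball₂⟩ := Metric.mem_nhds_iff.1 (hso.mem_nhds hps)
  refine ⟨min θ₁ θ₂, lt_min hθ₁ hθ₂, fun p hp τ y hy ↦ ?_⟩
  have hpv : p ∈ v := hball₁ (Metric.mem_ball.2 (hp.trans_le (min_le_left _ _)))
  have hpS : p ∈ s := hball₂ (Metric.mem_ball.2 (hp.trans_le (min_le_right _ _)))
  -- carry `y` to the time-`0` slab along the orbit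
  set e₀ : E4 := (Λ : E4 ≃L[ℝ] E4) (EuclideanSpace.single (0 : Fin 4) (1 : ℝ)) with he₀
  set y' : E4 := y + (-τ) • e₀ with hy'
  have hy'slab : y' ∈ Subtype.val '' (({boostedKerrBackground Λ c M' a' with bilin := boostedKerrBilin Λ c M' a'} : ModelBackground)).truncTimeSlab ρ 0 := by
    have h := freezing_add_smul_mem_slab Λ c M' a' (boostedKerrBilin Λ c M' a') hy (-τ)
    rwa [add_neg_cancel] at h
  rw [freezing_mem_slab_iff] at hy'slab
  obtain ⟨hy'U, hy't, hy'r⟩ := hy'slab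
  set z : E4 := poincareInv Λ c y' with hz
  have hzK : z ∈ Kz := by
    refine ⟨hy't, ?_, hy'r⟩
    have h := Kerr.mem_exterior.1 (mem_boostedKerrExterior.1 hy'U)
    exact ((le_max_left _ _).trans_lt h).le
  have hy'K : y' ∈ K := ⟨z, hzK, captureB_boost_poincareInv Λ c y'⟩
  -- radii at `y` and at `y'` (the orbit preserves the rest-frame radius)
  have hyU : y ∈ (boostedKerrExterior Λ c M' a' : Set E4) := ((freezing_mem_slab_iff Λ c M' a' _ ρ τ y).1 hy).1
  have hradz : 0 < Kerr.radius p.2 z := hrad p hpS z hzK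
  have hrady' : 0 < Kerr.radius p.2 (poincareInv Λ c y') := hradz
  have hrady : 0 < Kerr.radius p.2 (poincareInv Λ c y) := by
    have h := KerrSchildChart.radius_add_smul Λ c M' p.2 y' τ
    simp only [boostedKerrBackground] at h
    have hyy : y' + τ • e₀ = y := by rw [hy']; module
    rw [he₀] at hyy
    rw [hyy] at h
    rw [h]
    exact hrady'
  have hradinf' : 0 < Kerr.radius a' (poincareInv Λ c y') := hrad (M', a') hps z hzK
  refine ⟨hrady, ?_⟩
  -- stationarity, then the joint jets at `y'`
  have hst := freezing_iteratedFDeriv_boosted_sub_add_smul Λ c p (M', a') m y' τ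
  have hyy : y' + τ • e₀ = y := by rw [hy']; module
  simp only [he₀] at hyy
  rw [hyy] at hst
  simp only at hst
  rw [hst]
  have hcp : ContDiffAt ℝ m (boostedKerrBilin Λ c p.1 p.2) y' :=
    (freezing_contDiffAt_boosted Λ c p hrady').of_le (mod_cast le_top)
  have hcq : ContDiffAt ℝ m (boostedKerrBilin Λ c M' a') y' :=
    (freezing_contDiffAt_boosted Λ c (M', a') hradinf').of_le (mod_cast le_top)
  have hsub : iteratedFDeriv ℝ m (fun z ↦ boostedKerrBilin Λ c p.1 p.2 z - boostedKerrBilin Λ c M' a' z) y' =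
      f p y' - f (M', a') y' := by
    simp only [hf]
    rw [← iteratedFDeriv_sub_apply hcp hcq]
    rfl
  rw [hsub]
  have hd : dist (f p y') (f (M', a') y') < ε := hvu p hpv y' hy'K
  have hd' : dist (f p y') (f (M', a') y') = ‖f p y' - f (M', a') y'‖ := dist_eq_norm (f p y') (f (M', a') y')
  rw [hd'] at hd
  exact hd.le

/-- **Uniform continuity of the slab jets, all orders `≤ k` at once** (minimum of the `θ` of
`captureB_uniform_jets` over `m ≤ k`). [cite: KerrSchild1965, §2] -/
theorem captureB_uniform_jets_le (hM' : 0 < M') (k : ℕ) (ρ : ℝ) {ε : ℝ} (hε : 0 < ε) :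
    ∃ θ : ℝ, 0 < θ ∧ ∀ m ≤ k, ∀ p : ℝ × ℝ, dist p (M', a') < θ → ∀ (τ : ℝ),
      ∀ y ∈ Subtype.val '' (({boostedKerrBackground Λ c M' a' with bilin := boostedKerrBilin Λ c M' a'} : ModelBackground)).truncTimeSlab ρ τ,
        0 < Kerr.radius p.2 (poincareInv Λ c y) ∧
        ‖iteratedFDeriv ℝ m (fun z ↦ boostedKerrBilin Λ c p.1 p.2 z - boostedKerrBilin Λ c M' a' z) y‖ ≤ ε := by
  induction k with
  | zero =>
    obtain ⟨θ, hθ, h⟩ := captureB_uniform_jets Λ c M' a' hM' 0 ρ hε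
    exact ⟨θ, hθ, fun m hm ↦ by rw [Nat.le_zero.1 hm]; exact h⟩
  | succ k ih =>
    obtain ⟨θ, hθ, h⟩ := ih
    obtain ⟨θ', hθ', h'⟩ := captureB_uniform_jets Λ c M' a' hM' (k + 1) ρ hε
    refine ⟨min θ θ', lt_min hθ hθ', fun m hm p hp τ y hy ↦ ?_⟩
    rcases Nat.of_le_succ hm with hmk | hmk
    · exact h m hmk p (hp.trans_le (min_le_left _ _)) τ y hy
    · rw [hmk]
      exact h' p (hp.trans_le (min_le_right _ _)) τ y hy

/-! ### Fixed slabs -/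

-- long statements; the structure-update backgrounds and the operator-norm instance paths unify slowly
set_option synthInstance.maxHeartbeats 200000 in
set_option maxHeartbeats 3200000 in
/-- **`Cᵏ` convergence on a fixed slab from `C⁰` normalisation and windowed closeness.** Let `0 < M'`,
`y₀` an anchor of the reference exterior, `ρ ≥ r_{a'}(y₀)`, `ρ ≥ |χ|/m₀ + 1`. If for every `ε > 0`
eventually some window member is `ε`-close in `Cᵏ` to `Ψ^* g` on the slab of radius `ρ`, and the
reference member is the `C⁰` limit on the anchor slab, then `δᵏ_ρ(τ; M', a') → 0`. [cite: KerrSchild1965, §2] -/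
theorem captureB_tendsto_fixed (hΨ : ContMDiff 𝓘(ℝ, E4) (𝓡 4) ∞ Ψ) (hM' : 0 < M') {y₀ : E4}
    (h0 : y₀ 0 = 0) (h1 : y₀ 1 = 0) (h2 : y₀ 2 ≠ 0) (h3 : y₀ 3 ≠ 0)
    (hy₀ : max (Kerr.rPlus M' a') 0 < Kerr.radius a' y₀) {m₀ χ : ℝ} (hm₀ : 0 < m₀) (k : ℕ) {ρ : ℝ}
    (hρa : Kerr.radius a' y₀ ≤ ρ) (hρA : |χ| * m₀⁻¹ + 1 ≤ ρ)
    (hWk : ∀ ε : ℝ≥0∞, 0 < ε → ∀ᶠ τ : ℝ in atTop, ∃ p ∈ {q : ℝ × ℝ | m₀ ≤ q.1 ∧ q.1 ≤ m₀⁻¹ ∧ |q.2| ≤ χ * q.1},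
      𝓢.truncDeviationCk ({boostedKerrBackground Λ c M' a' with bilin := boostedKerrBilin Λ c (Prod.fst p) (Prod.snd p)} : ModelBackground) Ψ k ρ τ ≤ ε)
    (hN : Tendsto (fun τ : ℝ ↦ 𝓢.truncDeviationCk ({boostedKerrBackground Λ c M' a' with bilin := boostedKerrBilin Λ c M' a'} : ModelBackground) Ψ 0 (Kerr.radius a' y₀) τ)
      atTop (𝓝 0)) :
    Tendsto (fun τ : ℝ ↦ 𝓢.truncDeviationCk ({boostedKerrBackground Λ c M' a' with bilin := boostedKerrBilin Λ c M' a'} : ModelBackground) Ψ k ρ τ) atTop (𝓝 0) := by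
  rw [ENNReal.tendsto_nhds_zero]
  intro ε hε
  rcases eq_top_or_lt_top ε with hεtop | hεtop
  · exact Eventually.of_forall fun τ ↦ hεtop ▸ le_top
  have he : 0 < ε.toReal := ENNReal.toReal_pos hε.ne' hεtop.ne
  set e : ℝ := ε.toReal with hedef
  -- uniform jet continuity for orders `≤ k` at scale `e/2`, and the capture modulus
  obtain ⟨θ, hθ, hjets⟩ := captureB_uniform_jets_le Λ c M' a' hM' k ρ (half_pos he)
  obtain ⟨η, hη, hcap⟩ := captureA_dist_lt_of_le Λ c M' a' Ψ hM' h0 h1 h2 h3 hy₀ χ hm₀ hθ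
  set η' : ℝ := min η (e / 2) with hη'
  have hη'0 : 0 < η' := lt_min hη (half_pos he)
  have hE : (0 : ℝ≥0∞) < ENNReal.ofReal η' := ENNReal.ofReal_pos.2 hη'0
  have hev := (hWk (ENNReal.ofReal η') hE).and
    (ENNReal.tendsto_nhds_zero.1 hN (ENNReal.ofReal η) (ENNReal.ofReal_pos.2 hη))
  filter_upwards [hev] with τ hτ
  obtain ⟨⟨p, hp, hP⟩, hQ⟩ := hτ
  -- capture: `p` is `θ`-close to the reference member
  have hP0 : 𝓢.truncDeviationCk ({boostedKerrBackground Λ c M' a' with bilin := boostedKerrBilin Λ c (Prod.fst p) (Prod.snd p)} : ModelBackground) Ψ 0 (Kerr.radius a' y₀) τ ≤ ENNReal.ofReal η :=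
    calc 𝓢.truncDeviationCk ({boostedKerrBackground Λ c M' a' with bilin := boostedKerrBilin Λ c (Prod.fst p) (Prod.snd p)} : ModelBackground) Ψ 0 (Kerr.radius a' y₀) τ
        ≤ 𝓢.truncDeviationCk ({boostedKerrBackground Λ c M' a' with bilin := boostedKerrBilin Λ c (Prod.fst p) (Prod.snd p)} : ModelBackground) Ψ k (Kerr.radius a' y₀) τ :=
          captureA_truncDeviationCk_mono_k _ _ (Nat.zero_le k) _ _
      _ ≤ 𝓢.truncDeviationCk ({boostedKerrBackground Λ c M' a' with bilin := boostedKerrBilin Λ c (Prod.fst p) (Prod.snd p)} : ModelBackground) Ψ k ρ τ := 𝓢.truncDeviationCk_mono ({boostedKerrBackground Λ c M' a' with bilin := boostedKerrBilin Λ c (Prod.fst p) (Prod.snd p)} : ModelBackground) Ψ k hρa τ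
      _ ≤ ENNReal.ofReal η' := hP
      _ ≤ ENNReal.ofReal η := ENNReal.ofReal_le_ofReal (min_le_left _ _)
  have hdist : dist p (M', a') < θ := hcap τ p hp hP0 hQ
  -- disc exclusion for `p` from the finiteness of its distance
  have hyfin : 𝓢.truncDeviationCk ({boostedKerrBackground Λ c M' a' with bilin := boostedKerrBilin Λ c (Prod.fst p) (Prod.snd p)} : ModelBackground) Ψ k ρ τ ≠ ⊤ := ne_top_of_le_ne_top ENNReal.ofReal_ne_top hP
  have hdisc : p.2 ^ 2 ≤ a' ^ 2 + max (Kerr.rPlus M' a') 0 ^ 2 :=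
    freezing_sq_le_of_truncDeviationCk_ne_top Λ c M' a' Ψ hΨ (hm₀.trans_le hp.1)
      (freezing_abs_le_of_window hm₀ hp) hρA hyfin
  -- pointwise on the slab
  have hpt : ∀ m ≤ k, ∀ y ∈ Subtype.val '' (({boostedKerrBackground Λ c M' a' with bilin := boostedKerrBilin Λ c M' a'} : ModelBackground)).truncTimeSlab ρ τ,
      ‖iteratedFDeriv ℝ m (𝓢.deviationExtend ({boostedKerrBackground Λ c M' a' with bilin := boostedKerrBilin Λ c M' a'} : ModelBackground) Ψ) y‖ₑ ≤
        ENNReal.ofReal (e / 2) + ENNReal.ofReal (e / 2) := by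
    intro m hm y hy
    have hyU : y ∈ (boostedKerrExterior Λ c M' a' : Set E4) :=
      ((freezing_mem_slab_iff Λ c M' a' _ ρ τ y).1 hy).1
    have hyp : y ∈ Subtype.val '' (({boostedKerrBackground Λ c M' a' with bilin := boostedKerrBilin Λ c (Prod.fst p) (Prod.snd p)} : ModelBackground)).truncTimeSlab ρ τ := by
      rw [freezing_mem_slab_iff] at hy ⊢; exact hy
    have hradp : 0 < Kerr.radius p.2 (poincareInv Λ c y) := freezing_radius_pos_boosted Λ c hdisc hyU
    have hradinf : 0 < Kerr.radius a' (poincareInv Λ c y) :=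
      Kerr.radius_pos_of_mem_region (mem_boostedKerrExterior.1 hyU)
    have htri := freezing_enorm_iteratedFDeriv_dev_le (𝓢 := 𝓢) (boostedKerrBackground Λ c M' a') Ψ
      (boostedKerrBilin Λ c p.1 p.2) (boostedKerrBilin Λ c M' a') hΨ hyU
      (freezing_contDiffAt_boosted Λ c p hradp) (freezing_contDiffAt_boosted Λ c (M', a') hradinf) m
    have hA : ‖iteratedFDeriv ℝ m (𝓢.deviationExtend ({boostedKerrBackground Λ c M' a' with bilin := boostedKerrBilin Λ c (Prod.fst p) (Prod.snd p)} : ModelBackground) Ψ) y‖ₑ ≤ ENNReal.ofReal (e / 2) :=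
      calc ‖iteratedFDeriv ℝ m (𝓢.deviationExtend ({boostedKerrBackground Λ c M' a' with bilin := boostedKerrBilin Λ c (Prod.fst p) (Prod.snd p)} : ModelBackground) Ψ) y‖ₑ
          ≤ 𝓢.truncDeviationCk ({boostedKerrBackground Λ c M' a' with bilin := boostedKerrBilin Λ c (Prod.fst p) (Prod.snd p)} : ModelBackground) Ψ k ρ τ :=
            freezing_enorm_iteratedFDeriv_le_truncDeviationCk (𝓢 := 𝓢) (boostedKerrBackground Λ c M' a') Ψ
              (boostedKerrBilin Λ c p.1 p.2) hm hyp
        _ ≤ ENNReal.ofReal η' := hP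
        _ ≤ ENNReal.ofReal (e / 2) := ENNReal.ofReal_le_ofReal (min_le_right _ _)
    have hB : ‖iteratedFDeriv ℝ m (fun z ↦ boostedKerrBilin Λ c p.1 p.2 z - boostedKerrBilin Λ c M' a' z) y‖ₑ ≤
        ENNReal.ofReal (e / 2) := by
      rw [← ofReal_norm]
      exact ENNReal.ofReal_le_ofReal (hjets m hm p hdist τ y hy).2
    exact htri.trans (add_le_add hA hB)
  calc 𝓢.truncDeviationCk ({boostedKerrBackground Λ c M' a' with bilin := boostedKerrBilin Λ c M' a'} : ModelBackground) Ψ k ρ τ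
      ≤ ENNReal.ofReal (e / 2) + ENNReal.ofReal (e / 2) := by
        show supCkENorm _ k _ ≤ _
        exact iSup₂_le fun m hm ↦ iSup₂_le fun y hy ↦ hpt m hm y hy
    _ = ENNReal.ofReal (e / 2 + e / 2) := (ENNReal.ofReal_add (by linarith) (by linarith)).symm
    _ = ENNReal.ofReal e := by rw [add_halves]
    _ = ε := ENNReal.ofReal_toReal hεtop.ne

end Chart

/-- **Part B, registered form** (`captureB_isCompact_restSlab_sig`, the name under which this helper file is
attached to the crux item): the closed rest-frame slab `{z | z 0 = 0, r₊' ≤ r_{a'}(z) ≤ ρ}` is compact. [folklore] -/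
theorem captureB_isCompact_restSlab_sig : ∀ (M' a' ρ : ℝ), IsCompact {z : E4 | z 0 = 0 ∧ Kerr.rPlus M' a' ≤ Kerr.radius a' z ∧ Kerr.radius a' z ≤ ρ} :=
  fun M' a' ρ ↦ captureB_isCompact_restSlab M' a' ρ

end Summit.FinalStateConjecture.FinalStateConjecture.Theorems

end
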